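import Summits.Ventures.QEC.CircuitDistance.PortCycleSemantics
import HarnessLib

/-!
# P3-PORT (A2): the CLEAN-CYCLE LEMMA and the one-cycle SHAPE of a fault (cell `qec`, experiment CDX, seat qec-cdx-type-1)

* `frameOf` (a frame by its eight register components) and the explicit action of the four kinds of CNOT layers and of the
  two resets on it;
* `synZ`/`synX` — the syndrome bits in the circuit's time order — and `cleanFrame`;
* **`evolve_cycleEvents`** (CLEAN-CYCLE LEMMA): a fault-free cycle `c` on a state with `z`-clear `Z`-ancillas (`X`-ancillas
  arbitrary, `Z`-ancilla `x`-bits `ζ` allowed) records `mZ c ^= ζ ⊕ synZ(data x)`, `mX c ^= synX(data z)`, keeps the data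
  frame and cleans the ancillas — pure CNOT algebra, every `SMCode`;
* `shape S f` = the run of the fault's OWN cycle from the all-clear state, with `shape_ancZz`, `shape_ancZx` (`ζ ≠ 0` only
  for `InitZ`), `shape_mX_of_ne`/`shape_mZ_of_ne`, and `shape_retag` (moving a fault to another cycle moves its outcome
  slots only).
Generic in `S`; no table, no `decide`; nothing here asserts a value of `d_circ`.
-/

namespace Summit.Ventures.QEC.CircuitDistance

open Literature.InformationTheory.QuantumCodes

variable {ℓ m : ℕ}

/-! ## Register components of a frame -/

/-- A frame given by its eight register components (`x`/`z` bits of `q(X), q(L), q(R), q(Z)`). -/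
def frameOf (xX zX xL zL xR zR xZ zZ : BB.Mono ℓ m → Bool) : Frame ℓ m := fun q =>
  match q with
  | (.X, i) => (xX i, zX i)
  | (.L, i) => (xL i, zL i)
  | (.R, i) => (xR i, zR i)
  | (.Z, i) => (xZ i, zZ i)

/-- Every frame is the frame of its components. -/
theorem frameOf_eta (F : Frame ℓ m) :
    frameOf (fun i => (F (.X, i)).1) (fun i => (F (.X, i)).2) (fun i => (F (.L, i)).1) (fun i => (F (.L, i)).2)
      (fun i => (F (.R, i)).1) (fun i => (F (.R, i)).2) (fun i => (F (.Z, i)).1) (fun i => (F (.Z, i)).2) = F := by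
  funext q; rcases q with ⟨r, i⟩; cases r <;> rfl

section layers
variable (xX zX xL zL xR zR xZ zZ : BB.Mono ℓ m → Bool) (μ : BB.Mono ℓ m)

/-- A CNOT layer `q(X) → q(L)`. -/
theorem cnotLayer_frameOf_XL :
    (frameOf xX zX xL zL xR zR xZ zZ).cnotLayer .X .L μ =
      frameOf xX (fun i => xor (zX i) (zL (i + μ))) (fun i => xor (xL i) (xX (i - μ))) zL xR zR xZ zZ := by
  funext q; rcases q with ⟨r, i⟩; cases r <;> simp [Frame.cnotLayer, frameOf]

/-- A CNOT layer `q(X) → q(R)`. -/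
theorem cnotLayer_frameOf_XR :
    (frameOf xX zX xL zL xR zR xZ zZ).cnotLayer .X .R μ =
      frameOf xX (fun i => xor (zX i) (zR (i + μ))) xL zL (fun i => xor (xR i) (xX (i - μ))) zR xZ zZ := by
  funext q; rcases q with ⟨r, i⟩; cases r <;> simp [Frame.cnotLayer, frameOf]

/-- A CNOT layer `q(L) → q(Z)`. -/
theorem cnotLayer_frameOf_LZ :
    (frameOf xX zX xL zL xR zR xZ zZ).cnotLayer .L .Z μ =
      frameOf xX zX xL (fun i => xor (zL i) (zZ (i + μ))) xR zR (fun i => xor (xZ i) (xL (i - μ))) zZ := by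
  funext q; rcases q with ⟨r, i⟩; cases r <;> simp [Frame.cnotLayer, frameOf]

/-- A CNOT layer `q(R) → q(Z)`. -/
theorem cnotLayer_frameOf_RZ :
    (frameOf xX zX xL zL xR zR xZ zZ).cnotLayer .R .Z μ =
      frameOf xX zX xL zL xR (fun i => xor (zR i) (zZ (i + μ))) (fun i => xor (xZ i) (xR (i - μ))) zZ := by
  funext q; rcases q with ⟨r, i⟩; cases r <;> simp [Frame.cnotLayer, frameOf]

/-- Clearing the `X`-ancillas. -/
theorem clearReg_frameOf_X :
    (frameOf xX zX xL zL xR zR xZ zZ).clearReg .X = frameOf (fun _ => false) (fun _ => false) xL zL xR zR xZ zZ := by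
  funext q; rcases q with ⟨r, i⟩; cases r <;> simp [Frame.clearReg, frameOf]

/-- Clearing the `Z`-ancillas. -/
theorem clearReg_frameOf_Z :
    (frameOf xX zX xL zL xR zR xZ zZ).clearReg .Z = frameOf xX zX xL zL xR zR (fun _ => false) (fun _ => false) := by
  funext q; rcases q with ⟨r, i⟩; cases r <;> simp [Frame.clearReg, frameOf]

end layers

variable [NeZero ℓ] [NeZero m]

/-- The `Z`-syndrome bit of check `j` of the `X`-type data error `ex`, accumulated in the circuit's time order
(layers `A1RZ, A3RZ, B1LZ, B2LZ, B3LZ, A2RZ`: ancilla `q(Z,j)` is the target of data qubit `j − μ`). -/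
def synZ (S : SMCode ℓ m) (ex : BB.Mono ℓ m ⊕ BB.Mono ℓ m → Bool) (j : BB.Mono ℓ m) : Bool :=
  xor (xor (xor (xor (xor (ex (.inr (j - S.amon 0))) (ex (.inr (j - S.amon 2)))) (ex (.inl (j - S.bmon 0))))
    (ex (.inl (j - S.bmon 1)))) (ex (.inl (j - S.bmon 2)))) (ex (.inr (j - S.amon 1)))

/-- The `X`-syndrome bit of check `i` of the `Z`-type data error `ez`, in the circuit's time order
(layers `A2XL, B2XR, B1XR, B3XR, A1XL, A3XL`: ancilla `q(X,i)` controls data qubit `i + μ`). -/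
def synX (S : SMCode ℓ m) (ez : BB.Mono ℓ m ⊕ BB.Mono ℓ m → Bool) (i : BB.Mono ℓ m) : Bool :=
  xor (xor (xor (xor (xor (ez (.inl (i + S.amon 1))) (ez (.inr (i + S.bmon 1)))) (ez (.inr (i + S.bmon 0))))
    (ez (.inr (i + S.bmon 2)))) (ez (.inl (i + S.amon 0)))) (ez (.inl (i + S.amon 2)))

/-- The frame a clean cycle leaves behind from a frame `F`: `X`-ancillas carry `(0, synX)` (cleared by the next `InitX`),
data unchanged, `Z`-ancillas clear. -/
def cleanFrame (S : SMCode ℓ m) (F : Frame ℓ m) : Frame ℓ m := fun q =>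
  match q with
  | (.X, i) => (false, synX S F.dataZb i)
  | (.L, i) => F (.L, i)
  | (.R, i) => F (.R, i)
  | (.Z, _) => (false, false)

/-- CLEAN-CYCLE LEMMA, component form. -/
theorem evolve_cycleEvents_frameOf (S : SMCode ℓ m) (c : ℕ) (xX zX xL zL xR zR xZ : BB.Mono ℓ m → Bool)
    (mX mZ : ℕ → BB.Mono ℓ m → Bool) :
    evolve S (cycleEvents c) ⟨frameOf xX zX xL zL xR zR xZ (fun _ => false), mX, mZ⟩ =
      ⟨frameOf (fun _ => false) (synX S (frameOf xX zX xL zL xR zR xZ (fun _ => false)).dataZb) xL zL xR zR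
          (fun _ => false) (fun _ => false),
       fun c' i => if c' = c then xor (mX c' i) (synX S (frameOf xX zX xL zL xR zR xZ (fun _ => false)).dataZb i) else mX c' i,
       fun c' j => if c' = c then xor (mZ c' j) (xor (xZ j) (synZ S (frameOf xX zX xL zL xR zR xZ (fun _ => false)).dataXb j))
         else mZ c' j⟩ := by
  simp only [cycleEvents, evolve_cons, evolve_nil, applyEv, Layer.ctrl, Layer.tgt, Layer.mon,
    clearReg_frameOf_X, clearReg_frameOf_Z, cnotLayer_frameOf_XL, cnotLayer_frameOf_XR, cnotLayer_frameOf_LZ,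
    cnotLayer_frameOf_RZ, Bool.false_xor, Bool.xor_false]
  refine State.ext' ?_ ?_ ?_
  · funext q; rcases q with ⟨r, i⟩
    cases r <;> simp [frameOf, synX, Frame.dataZb]
  · funext c' i
    simp only [frameOf, synX, Frame.dataZb, Sum.elim_inl, Sum.elim_inr, Bool.xor_assoc]
  · funext c' j
    simp only [frameOf, synZ, Frame.dataXb, Sum.elim_inl, Sum.elim_inr, Bool.xor_assoc]

/-- CLEAN-CYCLE LEMMA. A fault-free cycle `c` run on a state whose `Z`-ancillas carry no `z`-bits (`X`-ancillas
arbitrary — `InitX` is the first operation; `Z`-ancilla `x`-bits `ζ` allowed — they are measured then erased)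
records `mZ c ^= ζ ⊕ synZ(data x)`, `mX c ^= synX(data z)`, keeps the data frame and cleans the ancillas. Pure
CNOT algebra; holds for every `SMCode`. -/
theorem evolve_cycleEvents (S : SMCode ℓ m) (c : ℕ) (st : State ℓ m) (hZz : ∀ j, (st.frame (Reg.Z, j)).2 = false) :
    evolve S (cycleEvents c) st =
      ⟨cleanFrame S st.frame,
       fun c' i => if c' = c then xor (st.mX c' i) (synX S st.frame.dataZb i) else st.mX c' i,
       fun c' j => if c' = c then xor (st.mZ c' j) (xor (st.frame.ancZx j) (synZ S st.frame.dataXb j)) else st.mZ c' j⟩ := by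
  obtain ⟨F, mX, mZ⟩ := st
  have hF : F = frameOf (fun i => (F (.X, i)).1) (fun i => (F (.X, i)).2) (fun i => (F (.L, i)).1) (fun i => (F (.L, i)).2)
      (fun i => (F (.R, i)).1) (fun i => (F (.R, i)).2) (fun i => (F (.Z, i)).1) (fun _ => false) := by
    conv_lhs => rw [← frameOf_eta F]
    congr 1
    funext j; exact hZz j
  have hdZ : (frameOf (fun i => (F (.X, i)).1) (fun i => (F (.X, i)).2) (fun i => (F (.L, i)).1) (fun i => (F (.L, i)).2)
      (fun i => (F (.R, i)).1) (fun i => (F (.R, i)).2) (fun i => (F (.Z, i)).1) (fun _ => false)).dataZb = F.dataZb := by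
    funext q; rcases q with i | i <;> rfl
  have hdX : (frameOf (fun i => (F (.X, i)).1) (fun i => (F (.X, i)).2) (fun i => (F (.L, i)).1) (fun i => (F (.L, i)).2)
      (fun i => (F (.R, i)).1) (fun i => (F (.R, i)).2) (fun i => (F (.Z, i)).1) (fun _ => false)).dataXb = F.dataXb := by
    funext q; rcases q with i | i <;> rfl
  conv_lhs => rw [hF]
  rw [evolve_cycleEvents_frameOf, hdZ, hdX]
  refine State.ext' ?_ rfl rfl
  funext q; rcases q with ⟨r, i⟩
  cases r <;> simp [frameOf, cleanFrame]

/-- A clean frame has `z`-clear `Z`-ancillas. -/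
theorem cleanFrame_Zz (S : SMCode ℓ m) (F : Frame ℓ m) (j : BB.Mono ℓ m) : (cleanFrame S F (Reg.Z, j)).2 = false := rfl

/-- A clean frame has `x`-clear `Z`-ancillas. -/
theorem cleanFrame_ancZx (S : SMCode ℓ m) (F : Frame ℓ m) : (cleanFrame S F).ancZx = fun _ => false := rfl

/-- Cleaning keeps the data `x`-bits. -/
theorem cleanFrame_dataXb (S : SMCode ℓ m) (F : Frame ℓ m) : (cleanFrame S F).dataXb = F.dataXb := by
  funext q; rcases q with i | i <;> rfl

/-- Cleaning keeps the data `z`-bits. -/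
theorem cleanFrame_dataZb (S : SMCode ℓ m) (F : Frame ℓ m) : (cleanFrame S F).dataZb = F.dataZb := by
  funext q; rcases q with i | i <;> rfl

/-- Cleaning is idempotent. -/
theorem cleanFrame_cleanFrame (S : SMCode ℓ m) (F : Frame ℓ m) : cleanFrame S (cleanFrame S F) = cleanFrame S F := by
  funext q; rcases q with ⟨r, i⟩
  cases r <;> simp [cleanFrame, cleanFrame_dataZb]

end Summit.Ventures.QEC.CircuitDistance

namespace Summit.Ventures.QEC.CircuitDistance

open Literature.InformationTheory.QuantumCodes

variable {ℓ m : ℕ} [NeZero ℓ] [NeZero m]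

/-! ## The one-cycle SHAPE of a fault -/

/-- The ONE-CYCLE SHAPE of a fault: the state after running just its own cycle from the all-clear state. -/
def shape (S : SMCode ℓ m) (f : Fault ℓ m) : State ℓ m := simulate S f (cycleEvents f.cyc) State.init

omit [NeZero ℓ] [NeZero m] in
/-- The last three operations of a cycle. -/
theorem cycleEvents_eq_append (c : ℕ) :
    cycleEvents c = [.initX c, .cnot c .A1RZ, .idle c .L1, .cnot c .A2XL, .cnot c .A3RZ, .cnot c .B2XR, .cnot c .B1LZ,
      .cnot c .B1XR, .cnot c .B2LZ, .cnot c .B3XR, .cnot c .B3LZ, .cnot c .A1XL, .cnot c .A2RZ, .cnot c .A3XL,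
      .measZ c, .idle c .R7, .measX c] ++ [.initZ c, .idle c .L8, .idle c .R8] := rfl

/-- Whatever happened before, after `InitZ, idle, idle` (with the fault possibly injected there) the `Z`-ancilla `j`
carries `(f = InitZ@c on j, 0)`. -/
theorem simulate_tail_Z (S : SMCode ℓ m) (f : Fault ℓ m) (c : ℕ) (st : State ℓ m) (j : BB.Mono ℓ m) :
    (simulate S f [.initZ c, .idle c .L8, .idle c .R8] st).frame (Reg.Z, j) = (decide (f = Fault.initZ c j), false) := by
  have hclr : ∀ F : Frame ℓ m, (F.clearReg Reg.Z) (Reg.Z, j) = (false, false) := fun F => by simp [Frame.clearReg]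
  have hmul : ∀ (F : Frame ℓ m) (r : Reg) (i : BB.Mono ℓ m) (p : P1), r ≠ Reg.Z →
      (F.mulAt (r, i) p) (Reg.Z, j) = F (Reg.Z, j) := by
    intro F r i p hr
    have : ((Reg.Z, j) : Qubit ℓ m) ≠ (r, i) := fun h => hr (Prod.mk.inj h).1.symm
    simp [Frame.mulAt, this]
  cases f with
  | cnot c' lay i pc pt => simp [simulate_cons, applyEv, Fault.ev, hclr]
  | idle c' s i p =>
    cases s <;> simp [simulate_cons, applyEv, inject, Fault.ev, IdleSlot.reg, hclr] <;> split_ifs <;>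
      simp [hmul, hclr]
  | initX c' i => simp [simulate_cons, applyEv, Fault.ev, hclr]
  | initZ c' i =>
    by_cases hc : Ev.initZ c = Ev.initZ c'
    · have hc' : c' = c := by cases hc; rfl
      subst hc'
      simp only [simulate_cons, simulate_nil, applyEv, inject, Fault.ev, if_true]
      by_cases hij : i = j
      · subst hij; simp [Frame.mulAt, Frame.clearReg, P1.mul_def]
      · have hne : ((Reg.Z, j) : Qubit ℓ m) ≠ (Reg.Z, i) := fun h => hij (Prod.mk.inj h).2.symm
        simp [Frame.mulAt, Frame.clearReg, hne, hij]
    · have hc' : c' ≠ c := fun h => hc (h ▸ rfl)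
      simp [simulate_cons, applyEv, Fault.ev, hclr, hc, hc']
  | measX c' i => simp [simulate_cons, applyEv, Fault.ev, hclr]
  | measZ c' i => simp [simulate_cons, applyEv, Fault.ev, hclr]

/-- After its own cycle a fault leaves the `Z`-ancillas `z`-clear … -/
theorem shape_ancZz (S : SMCode ℓ m) (f : Fault ℓ m) (j : BB.Mono ℓ m) : ((shape S f).frame (Reg.Z, j)).2 = false := by
  unfold shape; rw [cycleEvents_eq_append, simulate_append, simulate_tail_Z]

/-- … and `x`-clear except for an `InitZ` fault on that very ancilla (`ζ`). -/
theorem shape_ancZx (S : SMCode ℓ m) (f : Fault ℓ m) (j : BB.Mono ℓ m) :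
    (shape S f).frame.ancZx j = decide (f = Fault.initZ f.cyc j) := by
  unfold shape Frame.ancZx; rw [cycleEvents_eq_append, simulate_append, simulate_tail_Z]

/-- Invariant: outcome slots other than `c` stay clear while running cycle-`c` events with a cycle-`c` fault. -/
theorem simulate_slots_of_ne (S : SMCode ℓ m) (f : Fault ℓ m) (c : ℕ) (hf : f.cyc = c) (es : List Ev)
    (hes : ∀ e ∈ es, e.cyc = c) (st : State ℓ m)
    (hst : ∀ t, t ≠ c → (∀ i, st.mX t i = false) ∧ (∀ j, st.mZ t j = false)) :
    ∀ t, t ≠ c → (∀ i, (simulate S f es st).mX t i = false) ∧ (∀ j, (simulate S f es st).mZ t j = false) := by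
  induction es generalizing st with
  | nil => simpa using hst
  | cons e es ih =>
    rw [simulate_cons]
    apply ih (fun e' he' => hes e' (List.mem_cons_of_mem _ he'))
    have hec : e.cyc = c := hes e List.mem_cons_self
    -- the ideal step preserves the invariant
    have h1 : ∀ t, t ≠ c → (∀ i, (applyEv S e st).mX t i = false) ∧ (∀ j, (applyEv S e st).mZ t j = false) := by
      intro t ht
      obtain ⟨hX, hZ⟩ := hst t ht
      cases e with
      | cnot c' lay => exact ⟨hX, hZ⟩
      | idle c' s => exact ⟨hX, hZ⟩
      | initX c' => exact ⟨hX, hZ⟩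
      | initZ c' => exact ⟨hX, hZ⟩
      | measX c' =>
        have : t ≠ c' := by simp [Ev.cyc] at hec; omega
        refine ⟨fun i => ?_, hZ⟩
        simp [applyEv, this, hX i]
      | measZ c' =>
        have : t ≠ c' := by simp [Ev.cyc] at hec; omega
        refine ⟨hX, fun j => ?_⟩
        simp [applyEv, this, hZ j]
    split_ifs with he
    · -- the injection preserves the invariant
      intro t ht
      obtain ⟨hX, hZ⟩ := h1 t ht
      cases f with
      | cnot c' lay i pc pt => exact ⟨hX, hZ⟩
      | idle c' s i p => exact ⟨hX, hZ⟩
      | initX c' i => exact ⟨hX, hZ⟩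
      | initZ c' i => exact ⟨hX, hZ⟩
      | measX c' i =>
        have : t ≠ c' := by simp [Fault.cyc] at hf; omega
        refine ⟨fun i' => ?_, hZ⟩
        simp [inject, this, hX i']
      | measZ c' i =>
        have : t ≠ c' := by simp [Fault.cyc] at hf; omega
        refine ⟨hX, fun j => ?_⟩
        simp [inject, this, hZ j]
    · exact h1

/-- The shape only writes the outcome slots of its own cycle (`X`-checks). -/
theorem shape_mX_of_ne (S : SMCode ℓ m) (f : Fault ℓ m) {t : ℕ} (ht : t ≠ f.cyc) (i : BB.Mono ℓ m) :
    (shape S f).mX t i = false :=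
  ((simulate_slots_of_ne S f f.cyc rfl (cycleEvents f.cyc) (fun _ he => (mem_cycleEvents_iff _ _).1 he) State.init
    (fun _ _ => ⟨fun _ => rfl, fun _ => rfl⟩)) t ht).1 i

/-- The shape only writes the outcome slots of its own cycle (`Z`-checks). -/
theorem shape_mZ_of_ne (S : SMCode ℓ m) (f : Fault ℓ m) {t : ℕ} (ht : t ≠ f.cyc) (j : BB.Mono ℓ m) :
    (shape S f).mZ t j = false :=
  ((simulate_slots_of_ne S f f.cyc rfl (cycleEvents f.cyc) (fun _ he => (mem_cycleEvents_iff _ _).1 he) State.init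
    (fun _ _ => ⟨fun _ => rfl, fun _ => rfl⟩)) t ht).2 j

/-! ## Retagging -/

/-- Swap two outcome slots. -/
def State.swapSlots (c c' : ℕ) (st : State ℓ m) : State ℓ m :=
  ⟨st.frame, fun t i => st.mX (Equiv.swap c c' t) i, fun t j => st.mZ (Equiv.swap c c' t) j⟩

omit [NeZero ℓ] [NeZero m] in
/-- Retagging is injective on events of one cycle. -/
theorem Ev.retag_inj {e e' : Ev} (c' : ℕ) (h : e.retag c' = e'.retag c') (hc : e.cyc = e'.cyc) : e = e' := by
  cases e <;> cases e' <;> simp_all [Ev.retag, Ev.cyc]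

/-- Ideal steps commute with retag/swap. -/
theorem applyEv_retag_swap (S : SMCode ℓ m) (e : Ev) (c' : ℕ) (st : State ℓ m) :
    applyEv S (e.retag c') (st.swapSlots e.cyc c') = (applyEv S e st).swapSlots e.cyc c' := by
  cases e <;> refine State.ext' rfl ?_ ?_ <;> funext t i <;>
    simp only [applyEv, Ev.retag, Ev.cyc, State.swapSlots] <;> split_ifs <;>
    simp_all [Equiv.swap_apply_def] <;> split_ifs at * <;> simp_all

/-- Injections commute with retag/swap. -/
theorem inject_retag_swap (S : SMCode ℓ m) (f : Fault ℓ m) (c' : ℕ) (st : State ℓ m) :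
    inject S (f.retag c') (st.swapSlots f.cyc c') = (inject S f st).swapSlots f.cyc c' := by
  cases f <;> refine State.ext' rfl ?_ ?_ <;> funext t i <;>
    simp only [inject, Fault.retag, Fault.cyc, State.swapSlots] <;> split_ifs <;>
    simp_all [Equiv.swap_apply_def] <;> split_ifs at * <;> simp_all

/-- The simulation of one cycle commutes with retag/swap. -/
theorem simulate_retag_swap (S : SMCode ℓ m) (f : Fault ℓ m) (c' : ℕ) (es : List Ev) (hes : ∀ e ∈ es, e.cyc = f.cyc)
    (st : State ℓ m) :
    simulate S (f.retag c') (es.map (Ev.retag c')) (st.swapSlots f.cyc c') = (simulate S f es st).swapSlots f.cyc c' := by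
  induction es generalizing st with
  | nil => rfl
  | cons e es ih =>
    have hec : e.cyc = f.cyc := hes e List.mem_cons_self
    rw [List.map_cons, simulate_cons, simulate_cons, ← hec, applyEv_retag_swap, hec]
    have hiff : (e.retag c' = (f.retag c').ev) ↔ (e = f.ev) := by
      rw [Fault.ev_retag]
      constructor
      · intro h; exact Ev.retag_inj c' h (by rw [hec, Fault.ev_cyc])
      · intro h; rw [h]
    by_cases he : e = f.ev
    · rw [if_pos (hiff.2 he), if_pos he, inject_retag_swap]
      exact ih (fun e' he' => hes e' (List.mem_cons_of_mem _ he')) _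
    · rw [if_neg (fun h => he (hiff.1 h)), if_neg he]
      exact ih (fun e' he' => hes e' (List.mem_cons_of_mem _ he')) _

omit [NeZero ℓ] [NeZero m] in
/-- The events of a cycle, retagged, are the events of the new cycle. -/
theorem cycleEvents_retag (c c' : ℕ) : (cycleEvents c).map (Ev.retag c') = cycleEvents c' := rfl

/-- Retagging a fault to another cycle moves its outcome slots and nothing else. -/
theorem shape_retag (S : SMCode ℓ m) (f : Fault ℓ m) (c' : ℕ) :
    shape S (f.retag c') = ⟨(shape S f).frame, fun t i => if t = c' then (shape S f).mX f.cyc i else false,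
      fun t j => if t = c' then (shape S f).mZ f.cyc j else false⟩ := by
  have h := simulate_retag_swap S f c' (cycleEvents f.cyc) (fun _ he => (mem_cycleEvents_iff _ _).1 he) State.init
  rw [cycleEvents_retag] at h
  have hs : shape S (f.retag c') = (shape S f).swapSlots f.cyc c' := by
    unfold shape; rw [Fault.cyc_retag]; exact h
  rw [hs]
  refine State.ext' rfl ?_ ?_
  · funext t i
    simp only [State.swapSlots, Equiv.swap_apply_def]
    by_cases h1 : t = f.cyc
    · subst h1
      by_cases h2 : f.cyc = c'
      · simp [h2]
      · simp [h2, shape_mX_of_ne S f (Ne.symm h2)]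
    · by_cases h2 : t = c'
      · subst h2; simp only [if_true]
        by_cases h3 : t = f.cyc
        · rw [if_pos h3, h3]
        · rw [if_neg h3]
      · simp [h1, h2, shape_mX_of_ne S f h1]
  · funext t j
    simp only [State.swapSlots, Equiv.swap_apply_def]
    by_cases h1 : t = f.cyc
    · subst h1
      by_cases h2 : f.cyc = c'
      · simp [h2]
      · simp [h2, shape_mZ_of_ne S f (Ne.symm h2)]
    · by_cases h2 : t = c'
      · subst h2; simp only [if_true]
        by_cases h3 : t = f.cyc
        · rw [if_pos h3, h3]
        · rw [if_neg h3]
      · simp [h1, h2, shape_mZ_of_ne S f h1]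

end Summit.Ventures.QEC.CircuitDistance
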